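import Summits.ABC.IUTFork.Repair.RHHeightClassSigmaDoor
import Summits.ABC.IUTFork.Repair.RHInSigmaDatum
import Summits.ABC.IUTFork.Repair.RHSigmaLicence
import Summits.ABC.IUTFork.Cor312LicenceShallowRealising
import Summits.ABC.IUTFork.Cor312LicenceShallowMultiSlotGenuineKInhabited
import HarnessLib

/-!
# R-H ROUND 2, Q2 row 8 «heightclass», CELL LEVEL at REALISING ideles: the licence on the row-8 cell window Σ₈ = `sigmaHBand` is a THEOREM
# WITH NO CANDIDATE HYPOTHESIS — `LicenceOn (settingPrVolSharp …) (sigmaHBand X)` for realising ideles, and hypothesis-free at the chosen ideles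

PROOF-ONLY file (D-0012: 0 definitions, 0 `Prop` facts) of the abc-iut cell, rung LADDER-ABC:A2.RP → A2.RESCUE.H (seat abc-iut-rp-m2 gen 6 =
R-H k2 DESK hand #8, row 8). Companion of p470903 `Repair/RHHeightClassSigmaDoor.lean` (Σ₈ := `sigmaHBand X` = the cells `(i, v_ℚ)` where
abc-iut-lens-strengthen-1's `RHHeightClass.HBand` packet clause holds; `licenceAt_of_mem_sigmaHBand` = S|Σ₈ under the sharp idele profile) and of
p473818 `Repair/RHHeightClassRealising.lean` (the profile discharged for REALISING ideles). Here the two are composed in abc-iut-rh2-q2-eq's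
round-2 currency `Repair.RH.SigmaLicence.LicenceOn P Σ` (p468453: «∀ (i, v_ℚ) ∈ Σ, qRegion_{i+1,v_ℚ} ⊆ ⁿ˚𝒰_{i+1,v_ℚ}»):
* §1 **`licenceOn_sigmaHBand_of_realises`** — ANY pilot datum `X`, ideles REALISING the pilot divisors in Dupuy–Hilado's normalisation (the `ht`/`htq`
  binders of the branch-C certificates), `P_q(w) ∈ ℕ` on `S`: `LicenceOn (settingPrVolSharp X …) (sigmaHBand X)` — NO hypothesis about the candidate:
  Σ₈ is the TRUTH SET of its cells, and on that set the (xi-f) licence holds (abc-iut-w5-d236's norm identities discharge the profile).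
* §2 **`licenceOn_sigmaHBand_pilotDataOfK_of_realises`** — the genuine bed, ANY realising ideles over `K` (integrality = abc-iut-w5-d107's
  `Cor312Prov.exists_nat_qPilot_pilotDataOfK`, [IUTchI] Ex. 3.2 (iv)).
* §3 **`licenceOn_sigmaHBand_pilotDataOfK_chosen`** — at the CHOSEN realising ideles of `Conditional.abc_of_SH_v10K_window` /
  `abc_of_SHSigma_v10K_window` / abc-iut-rh2-q2-eq's `RH.SigmaStrataEq.abc_of_licenceOn_of_offRemainder_le_tol` (coric shells of `analyticLogv K`):
  **hypothesis-free** — the [LIC, WINDOW] binder of the Σ-strata certificates at `σ(T) := sigmaHBand (pilotDataOfK T.D T.K)` is a THEOREM at every datum.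
HONEST SCOPE: OUR typed sharp containers and Dupuy–Hilado's typed (Ind2); STRONGER-THAN-PRINT hull reading (ADJUDICATION-SPEC §2 (G1′)); Σ₈ may be
small or empty of nonarchimedean cells at a given datum (which cells of genuine data lie in Σ₈ is round-2 Q3 numerics — abc-iut-rh2-q3-num /
rh-kit-2 — NOT claimed); nothing about the printed GLOBAL inequality. TAKES NO SIDE on [IUTchIII] Cor. 3.12 or on any author; `HBand` / Σ₈ /
`LicenceOn` are reading predicates (claim-tagged by their typers), never asserted beyond what is proved; nothing asserts abc proved or refuted;
typed ≠ proved; instantiated ≠ endorsed. [cite: Mochizuki2012, IUTchI Ex. 3.2 (iv) p. 71; IUTchIII Cor. 3.12 p. 173–174, Step (xi-f) p. 184;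
IUTchIV Prop. 1.2 (i) p. 10] [cite: DupuyHilado2025, §3.3, §3.4, §3.9, §4.9] [cite: NeukirchANT1999, Ch. I §8 Prop. (8.2), Ch. II Prop. (5.5)]
[claim: Mochizuki2012, status: disputed] for every IUT locution. Axioms: standard.
-/

noncomputable section

open Set Metric Function
open scoped Pointwise

namespace Summit.ABC.IUTFork.Repair.RHHeightClassSigmaLicence

open NumberField IsDedekindDomain Literature.IUT.LogThetaLattice Literature.IUT.LogVolume Literature.IUT.HodgeTheaters
  Literature.IUT.LogVolume.ThetaData Literature.NumberTheory.NumberFields Literature.NumberTheory.GaloisRepresentations.Ultrametric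
  Summit.ABC.IUTFork.Thm311 Summit.ABC.IUTFork.Thm311.Real Summit.ABC.IUTFork.Cor312 Summit.ABC.IUTFork.Cor312.Setting
  Summit.ABC.IUTFork.Cor312Vol Summit.ABC.IUTFork.Cor312Prov Summit.ABC.IUTFork.Repair.RH.SigmaLicence

/-! ## §1. Any pilot datum, realising ideles with integer `P_q` on `S`: the licence on Σ₈ -/

section AnyDatum

variable {F : Type} [Field F] [NumberField F] (X : PilotData F) {logv : PadicLogs F} (hlog : LogvAnalytic logv)
  (M : Type) [Field M] [NumberField M]
  (archPk : ∀ (j : (thetaIndex X).Label) (vQ : (thetaIndex X).VQ), Set ((logShellsDH X logv).Packet j vQ))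
  (archSub : ∀ (j : (thetaIndex X).Label) (v : (thetaIndex X).V),
    Set ((logShellsDH X logv).Packet j ((thetaIndex X).over v)))
  (Ψ : ℤ → ∀ v : (thetaIndex X).V, v ∈ (thetaIndex X).Vbad → Set ((logShellsDH X logv).StarPacket v))
  (act : ℤ → ∀ v : (thetaIndex X).V, v ∈ (thetaIndex X).Vbad →
    (logShellsDH X logv).StarPacket v → Module.End ℚ ((logShellsDH X logv).StarPacket v))
  (Mmod : ℤ → ∀ j : (thetaIndex X).LabelStar, Set ((logShellsDH X logv).GlobalPacket j.1))
  (region : ℤ → ∀ j : (thetaIndex X).LabelStar, FinDivisor M → ∀ vQ : (thetaIndex X).VQ,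
    Set ((logShellsDH X logv).Packet j.1 vQ))
  (n : ℤ) {HT : Type} {LogLink : HT → HT → Type} {IsFull : ∀ {s t : HT}, LogLink s t → Prop}
  (lat : LGPGaussianLogThetaLattice LogLink IsFull)
  {Frd : Type} {IsoF : Frd → Frd → Type} {Ob : Frd → Type} {realify : Frd → Frd} {Strip : Type}
  {IsoS : Strip → Strip → Type} {Mv : ∀ v : (thetaIndex X).V, v ∈ (thetaIndex X).Vbad → Type}
  [∀ v h, Monoid (Mv v h)]
  (sig : GlobalLGPFrobenioidSignature (thetaIndex X).lstar (thetaIndex X).V (· ∈ (thetaIndex X).Vbad)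
    Frd IsoF Ob realify Strip IsoS Mv)
  (split : SplittingMonoids Mv) {ObΔ : Type} {N : ∀ v : (thetaIndex X).V, v ∈ (thetaIndex X).Vbad → Type}
  [∀ v h, Monoid (N v h)] (qData : QPilotData ObΔ N)
  (tq : ∀ (pp : Nat.Primes) (x : (thetaIndex X).Fibre (.inr pp)), haveI : Fact (pp : ℕ).Prime := ⟨pp.2⟩; kOf X pp.1 x)
  (t : ∀ (pp : Nat.Primes) (_ : Fin X.lstar) (x : (thetaIndex X).Fibre (.inr pp)),
    haveI : Fact (pp : ℕ).Prime := ⟨pp.2⟩; kOf X pp.1 x)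
  (htq0 : ∀ pp x, tq pp x ≠ 0)
  (htq1 : ∀ (pp : Nat.Primes) (x : (thetaIndex X).Fibre (.inr pp)),
    haveI : Fact (pp : ℕ).Prime := ⟨pp.2⟩; placeOf X pp.1 x ∉ X.S → ‖tq pp x‖ = 1)
  (col : ℤ → Column (logShellsDH X logv))

/-- **THE LICENCE ON Σ₈ AT REALISING IDELES (any pilot datum) — no candidate hypothesis.** If the Θ- and q-ideles REALISE the pilot divisors in
Dupuy–Hilado's normalisation and `P_q(w) ∈ ℕ` on `S`, then at EVERY cell of the row-8 window `sigmaHBand X` the (xi-f) licence holds at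
`settingPrVolSharp`: `LicenceOn (settingPrVolSharp …) (sigmaHBand X)`. p470903 `licenceAt_of_mem_sigmaHBand` with its idele profile supplied by
abc-iut-w5-d236's `norm_qIdele_eq_rpow_of_realises` / `norm_thetaIdele_eq_rpow_of_realises`. [cite: DupuyHilado2025, §3.3, §3.4, §3.9]
[claim: Mochizuki2012, status: disputed] -/
theorem licenceOn_sigmaHBand_of_realises
    (ht0 : ∀ pp i x, t pp i x ≠ 0)
    (ht : ∀ (pp : Nat.Primes) (i : Fin X.lstar) (x : (thetaIndex X).Fibre (.inr pp)),
      haveI : Fact (pp : ℕ).Prime := ⟨pp.2⟩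
      Real.log ‖t pp i x‖ = -(X.thetaPilot i (placeOf X pp.1 x)) * logNorm F (placeOf X pp.1 x) /
        localDegree F (placeOf X pp.1 x))
    (htq : ∀ (pp : Nat.Primes) (x : (thetaIndex X).Fibre (.inr pp)),
      haveI : Fact (pp : ℕ).Prime := ⟨pp.2⟩
      Real.log ‖tq pp x‖ = -(X.qPilot (placeOf X pp.1 x)) * logNorm F (placeOf X pp.1 x) /
        localDegree F (placeOf X pp.1 x))
    (hint : ∀ w ∈ X.S, ∃ m : ℕ, X.qPilot w = m) :
    LicenceOn (settingPrVolSharp X hlog M archPk archSub Ψ act Mmod region n lat sig split qData tq t htq0 htq1) (RHHeightClassSigmaDoor.sigmaHBand X) := by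
  classical
  haveI hne : ∀ pp : Nat.Primes, Fact (pp : ℕ).Prime := fun pp => ⟨pp.2⟩
  -- the norms of the realising ideles as powers of `p`
  have hnq : ∀ (pp : Nat.Primes) (x : (thetaIndex X).Fibre (.inr pp)),
      ‖tq pp x‖ = ((pp : ℕ) : ℝ) ^ (-(X.qPilot (placeOf X pp.1 x)) / (ramIdx F (placeOf X pp.1 x) : ℝ)) :=
    fun pp x => norm_qIdele_eq_rpow_of_realises (X := X) (tq := tq) (htq0 := htq0) (htq := htq) pp x
  have hnΘ : ∀ (pp : Nat.Primes) (i : Fin X.lstar) (x : (thetaIndex X).Fibre (.inr pp)),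
      ‖t pp i x‖ = ((pp : ℕ) : ℝ) ^ (-((((i : ℕ) + 1 : ℕ) : ℝ) ^ 2 * X.qPilot (placeOf X pp.1 x)) /
        (ramIdx F (placeOf X pp.1 x) : ℝ)) :=
    fun pp i x => norm_thetaIdele_eq_rpow_of_realises (X := X) (tq := tq) (t := t) (htq0 := htq0) (ht0 := ht0) (ht := ht)
      (htq := htq) pp i x
  -- integer Kummer orders `m_q := P_q` on `S` (and `0` elsewhere)
  set mq : ∀ pp : Nat.Primes, (thetaIndex X).Fibre (.inr pp) → ℤ := fun pp w =>
    if h : placeOf X pp.1 w ∈ X.S then ((hint _ h).choose : ℤ) else 0 with hmqdef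
  have hmq : ∀ (pp : Nat.Primes) (w : (thetaIndex X).Fibre (.inr pp)),
      placeOf X pp.1 w ∈ X.S → (mq pp w : ℝ) = X.qPilot (placeOf X pp.1 w) := by
    intro pp w hw
    rw [hmqdef]
    dsimp only
    rw [dif_pos hw]
    push_cast
    exact (hint _ hw).choose_spec.symm
  intro c hc
  refine RHHeightClassSigmaDoor.licenceAt_of_mem_sigmaHBand X hlog M archPk archSub Ψ act Mmod region n lat sig split qData tq t htq0 htq1
    mq (fun pp i x hx => ?_) hmq (fun pp w hw => ?_) (fun pp i w hw => ?_) c.1 c.2 hc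
  · -- `‖t_Θ‖ = 1` off `S`
    rw [hnΘ, X.qPilot_apply_of_not_mem hx, mul_zero, neg_zero, zero_div, Real.rpow_zero]
  · -- `‖t_q‖ = p^{−m_q/e}` at a bad place
    rw [hnq, ← hmq pp w hw]
  · -- `‖t_Θ‖ = p^{−(i+1)²·m_q/e}` at a bad place
    rw [hnΘ, ← hmq pp w hw]
    congr 1
    push_cast
    ring

end AnyDatum

/-! ## §2. The genuine `K`-level bed `pilotDataOfK D K`: integrality of `P_q` is a theorem — ANY realising ideles -/

section Genuine

variable {F K Fbar : Type} [Field F] [NumberField F] [Field K] [NumberField K] [Algebra F K] [Field Fbar]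
  [Algebra F Fbar] [Algebra K Fbar] {E : WeierstrassCurve F} [E.IsElliptic] {l : ℕ} {Pb : BadPlacePredicates K}
  (D : InitialThetaData F K Fbar E l Pb) (M : Type) [Field M] [NumberField M] {logv : PadicLogs K} (hlog : LogvAnalytic logv)
  (archPk : ∀ (j : (thetaIndex (pilotDataOfK D K)).Label) (vQ : (thetaIndex (pilotDataOfK D K)).VQ),
    Set ((logShellsDH (pilotDataOfK D K) logv).Packet j vQ))
  (archSub : ∀ (j : (thetaIndex (pilotDataOfK D K)).Label) (v : (thetaIndex (pilotDataOfK D K)).V),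
    Set ((logShellsDH (pilotDataOfK D K) logv).Packet j ((thetaIndex (pilotDataOfK D K)).over v)))
  (Ψ : ℤ → ∀ v : (thetaIndex (pilotDataOfK D K)).V, v ∈ (thetaIndex (pilotDataOfK D K)).Vbad →
    Set ((logShellsDH (pilotDataOfK D K) logv).StarPacket v))
  (act : ℤ → ∀ v : (thetaIndex (pilotDataOfK D K)).V, v ∈ (thetaIndex (pilotDataOfK D K)).Vbad →
    (logShellsDH (pilotDataOfK D K) logv).StarPacket v → Module.End ℚ ((logShellsDH (pilotDataOfK D K) logv).StarPacket v))
  (Mmod : ℤ → ∀ j : (thetaIndex (pilotDataOfK D K)).LabelStar, Set ((logShellsDH (pilotDataOfK D K) logv).GlobalPacket j.1))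
  (region : ℤ → ∀ j : (thetaIndex (pilotDataOfK D K)).LabelStar, FinDivisor M → ∀ vQ : (thetaIndex (pilotDataOfK D K)).VQ,
    Set ((logShellsDH (pilotDataOfK D K) logv).Packet j.1 vQ))
  (n : ℤ) {HT : Type} {LogLink : HT → HT → Type} {IsFull : ∀ {s t : HT}, LogLink s t → Prop}
  (lat : LGPGaussianLogThetaLattice LogLink IsFull)
  {Frd : Type} {IsoF : Frd → Frd → Type} {Ob : Frd → Type} {realify : Frd → Frd} {Strip : Type}
  {IsoS : Strip → Strip → Type}
  {Mv : ∀ v : (thetaIndex (pilotDataOfK D K)).V, v ∈ (thetaIndex (pilotDataOfK D K)).Vbad → Type} [∀ v h, Monoid (Mv v h)]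
  (sig : GlobalLGPFrobenioidSignature (thetaIndex (pilotDataOfK D K)).lstar (thetaIndex (pilotDataOfK D K)).V
    (· ∈ (thetaIndex (pilotDataOfK D K)).Vbad) Frd IsoF Ob realify Strip IsoS Mv)
  (split : SplittingMonoids Mv) {ObΔ : Type}
  {N : ∀ v : (thetaIndex (pilotDataOfK D K)).V, v ∈ (thetaIndex (pilotDataOfK D K)).Vbad → Type} [∀ v h, Monoid (N v h)]
  (qData : QPilotData ObΔ N)
  (tq : ∀ (pp : Nat.Primes) (x : (thetaIndex (pilotDataOfK D K)).Fibre (.inr pp)),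
    haveI : Fact (pp : ℕ).Prime := ⟨pp.2⟩; kOf (pilotDataOfK D K) pp.1 x)
  (t : ∀ (pp : Nat.Primes) (_ : Fin (pilotDataOfK D K).lstar) (x : (thetaIndex (pilotDataOfK D K)).Fibre (.inr pp)),
    haveI : Fact (pp : ℕ).Prime := ⟨pp.2⟩; kOf (pilotDataOfK D K) pp.1 x)
  (htq0 : ∀ pp x, tq pp x ≠ 0)
  (htq1 : ∀ (pp : Nat.Primes) (x : (thetaIndex (pilotDataOfK D K)).Fibre (.inr pp)),
    haveI : Fact (pp : ℕ).Prime := ⟨pp.2⟩; placeOf (pilotDataOfK D K) pp.1 x ∉ (pilotDataOfK D K).S → ‖tq pp x‖ = 1)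
  (col : ℤ → Column (logShellsDH (pilotDataOfK D K) logv))

/-- **THE LICENCE ON Σ₈ AT THE GENUINE BED, ANY REALISING IDELES** — hypotheses: only that `tq`, `t` realise the pilot divisors of
`pilotDataOfK D K` (integrality `P_q(w) ∈ ℕ` is `Cor312Prov.exists_nat_qPilot_pilotDataOfK`, [IUTchI] Ex. 3.2 (iv)). [cite: Mochizuki2012, IUTchI Ex. 3.2 (iv) p. 71]
[cite: DupuyHilado2025, §3.3, §3.4, §3.9] [claim: Mochizuki2012, status: disputed] -/
theorem licenceOn_sigmaHBand_pilotDataOfK_of_realises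
    (ht0 : ∀ pp i x, t pp i x ≠ 0)
    (ht : ∀ (pp : Nat.Primes) (i : Fin (pilotDataOfK D K).lstar) (x : (thetaIndex (pilotDataOfK D K)).Fibre (.inr pp)),
      haveI : Fact (pp : ℕ).Prime := ⟨pp.2⟩
      Real.log ‖t pp i x‖ = -((pilotDataOfK D K).thetaPilot i (placeOf (pilotDataOfK D K) pp.1 x)) *
        logNorm K (placeOf (pilotDataOfK D K) pp.1 x) / localDegree K (placeOf (pilotDataOfK D K) pp.1 x))
    (htq : ∀ (pp : Nat.Primes) (x : (thetaIndex (pilotDataOfK D K)).Fibre (.inr pp)),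
      haveI : Fact (pp : ℕ).Prime := ⟨pp.2⟩
      Real.log ‖tq pp x‖ = -((pilotDataOfK D K).qPilot (placeOf (pilotDataOfK D K) pp.1 x)) *
        logNorm K (placeOf (pilotDataOfK D K) pp.1 x) / localDegree K (placeOf (pilotDataOfK D K) pp.1 x)) :
    LicenceOn (settingPrVolSharp (pilotDataOfK D K) hlog M archPk archSub Ψ act Mmod region n lat sig split qData tq t htq0 htq1) (RHHeightClassSigmaDoor.sigmaHBand (pilotDataOfK D K)) :=
  licenceOn_sigmaHBand_of_realises (pilotDataOfK D K) hlog M archPk archSub Ψ act Mmod region n lat sig split qData tq t htq0 htq1 ht0 ht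
    htq (fun w hw => by
      obtain ⟨P, hP, -, -⟩ := exists_nat_qPilot_pilotDataOfK D hw
      exact ⟨P, hP⟩)

end Genuine

/-! ## §3. The CHOSEN realising ideles of the certificates of record: hypothesis-free -/

section Chosen

variable {F K Fbar : Type} [Field F] [NumberField F] [Field K] [NumberField K] [Algebra F K] [Field Fbar]
  [Algebra F Fbar] [Algebra K Fbar] {E : WeierstrassCurve F} [E.IsElliptic] {l : ℕ} {Pb : BadPlacePredicates K}
  (D : InitialThetaData F K Fbar E l Pb) (M : Type) [Field M] [NumberField M]
  (archPk : ∀ (j : (thetaIndex (pilotDataOfK D K)).Label) (vQ : (thetaIndex (pilotDataOfK D K)).VQ),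
    Set ((logShellsDH (pilotDataOfK D K) (analyticLogv K)).Packet j vQ))
  (archSub : ∀ (j : (thetaIndex (pilotDataOfK D K)).Label) (v : (thetaIndex (pilotDataOfK D K)).V),
    Set ((logShellsDH (pilotDataOfK D K) (analyticLogv K)).Packet j ((thetaIndex (pilotDataOfK D K)).over v)))
  (Ψ : ℤ → ∀ v : (thetaIndex (pilotDataOfK D K)).V, v ∈ (thetaIndex (pilotDataOfK D K)).Vbad →
    Set ((logShellsDH (pilotDataOfK D K) (analyticLogv K)).StarPacket v))
  (act : ℤ → ∀ v : (thetaIndex (pilotDataOfK D K)).V, v ∈ (thetaIndex (pilotDataOfK D K)).Vbad →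
    (logShellsDH (pilotDataOfK D K) (analyticLogv K)).StarPacket v →
      Module.End ℚ ((logShellsDH (pilotDataOfK D K) (analyticLogv K)).StarPacket v))
  (Mmod : ℤ → ∀ j : (thetaIndex (pilotDataOfK D K)).LabelStar, Set ((logShellsDH (pilotDataOfK D K) (analyticLogv K)).GlobalPacket j.1))
  (region : ℤ → ∀ j : (thetaIndex (pilotDataOfK D K)).LabelStar, FinDivisor M → ∀ vQ : (thetaIndex (pilotDataOfK D K)).VQ,
    Set ((logShellsDH (pilotDataOfK D K) (analyticLogv K)).Packet j.1 vQ))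
  (n : ℤ) {HT : Type} {LogLink : HT → HT → Type} {IsFull : ∀ {s t : HT}, LogLink s t → Prop}
  (lat : LGPGaussianLogThetaLattice LogLink IsFull)
  {Frd : Type} {IsoF : Frd → Frd → Type} {Ob : Frd → Type} {realify : Frd → Frd} {Strip : Type}
  {IsoS : Strip → Strip → Type}
  {Mv : ∀ v : (thetaIndex (pilotDataOfK D K)).V, v ∈ (thetaIndex (pilotDataOfK D K)).Vbad → Type} [∀ v h, Monoid (Mv v h)]
  (sig : GlobalLGPFrobenioidSignature (thetaIndex (pilotDataOfK D K)).lstar (thetaIndex (pilotDataOfK D K)).V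
    (· ∈ (thetaIndex (pilotDataOfK D K)).Vbad) Frd IsoF Ob realify Strip IsoS Mv)
  (split : SplittingMonoids Mv) {ObΔ : Type}
  {N : ∀ v : (thetaIndex (pilotDataOfK D K)).V, v ∈ (thetaIndex (pilotDataOfK D K)).Vbad → Type} [∀ v h, Monoid (N v h)]
  (qData : QPilotData ObΔ N)

/-- **THE LICENCE ON Σ₈ AT THE CERTIFICATES' CHOSEN IDELES — HYPOTHESIS-FREE.** At the genuine bed with the coric shells of `analyticLogv K` and
the realising q- and Θ-ideles CHOSEN in `Conditional.abc_of_SH_v10K_window` / `abc_of_SHSigma_v10K_window` / `RH.SigmaStrataEq.abc_of_licenceOn_…`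
(`(exists_realising_qIdeles_pilotDataOfK D).choose`, `(exists_realising_thetaIdeles_pilotDataOfK D).choose`), the (xi-f) licence holds at EVERY cell
of Σ₈ = `sigmaHBand (pilotDataOfK D K)`: the [LIC, WINDOW] binder of abc-iut-rh2-q2-eq's Σ-strata certificates at `σ(T) := sigmaHBand (pilotDataOfK T.D T.K)`
is a THEOREM at every datum. Nothing says how large Σ₈ is at a given datum (Q3). [cite: Mochizuki2012, IUTchI Ex. 3.2 (iv) p. 71]
[cite: DupuyHilado2025, §3.3, §3.4, §3.9] [claim: Mochizuki2012, status: disputed] -/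
theorem licenceOn_sigmaHBand_pilotDataOfK_chosen :
    LicenceOn
      (settingPrVolSharp (pilotDataOfK D K) (logvAnalytic_analyticLogv (F := K)) M archPk archSub Ψ act Mmod region n lat sig split qData
        (exists_realising_qIdeles_pilotDataOfK D).choose (exists_realising_thetaIdeles_pilotDataOfK D).choose
        (exists_realising_qIdeles_pilotDataOfK D).choose_spec.1 (exists_realising_qIdeles_pilotDataOfK D).choose_spec.2.1)
      (RHHeightClassSigmaDoor.sigmaHBand (pilotDataOfK D K)) :=
  licenceOn_sigmaHBand_pilotDataOfK_of_realises D M (logvAnalytic_analyticLogv (F := K)) archPk archSub Ψ act Mmod region n lat sig split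
    qData (exists_realising_qIdeles_pilotDataOfK D).choose (exists_realising_thetaIdeles_pilotDataOfK D).choose
    (exists_realising_qIdeles_pilotDataOfK D).choose_spec.1 (exists_realising_qIdeles_pilotDataOfK D).choose_spec.2.1
    (exists_realising_thetaIdeles_pilotDataOfK D).choose_spec.1 (exists_realising_thetaIdeles_pilotDataOfK D).choose_spec.2.2
    (exists_realising_qIdeles_pilotDataOfK D).choose_spec.2.2

end Chosen

end Summit.ABC.IUTFork.Repair.RHHeightClassSigmaLicence

end
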